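import Literature.NumberTheory.LFunctions.DirichletPolynomialCrudeMVT
import HarnessLib

/-!
# Mean square of an "activated" Dirichlet polynomial (t-dependent length) against a `C¹` weight

Topic `Literature/NumberTheory/LFunctions`. Everything in this file is PROVED (no definitions, no
named facts). Companion of `DirichletPolynomialCrudeMVT.lean` / `DirichletPolynomialOffDiagonalMVT.lean`.

The approximate functional equation of Hardy–Littlewood / Riemann–Siegel type has sums of the
t-dependent length `n ≤ √(t/2π)`; so the mean squares in Levinson's method (N. Levinson, *More than
one third of zeros of Riemann's zeta-function are on `σ = 1/2`*, Adv. Math. 13 (1974), §2 (2.22)–(2.27)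
and §4: `I₁₁ = ∫_T^{T+U} |ψ g₁(a+it)|² dt`, `I₂₂ = ∫ |χ|² |ψ g₂|²`, `g₁(s) = Σ_{n ≤ √(t/2π)} n^{−s}(…)`)
and already in the mean square of `ζ(½+it)` itself (Titchmarsh, *The Theory of the Riemann
Zeta-Function*, §7.4) are integrals of `|Σ_{i : τ_i ≤ t} x_i μ_i^{−it}|²`, a Dirichlet polynomial whose
terms (index `i = (k, n)`, frequency `μ_i = kn`, coefficient `x_i = b_k c_n (kn)^{−a}`) are switched on
at the times `τ_i = 2πn²`. Titchmarsh's treatment ("term-by-term integration … the `m ≠ n` terms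
give `O(Σ Σ 1/((mn)^{1/2} |log m/n|))`") is formalised here once and for all, for an arbitrary
finite index set, with a `C¹` weight `w(t)` (for `I₂₂`, `w(t) = (t/2π)^{1−2a}` is the main term of
`|χ(a+it)|²`, `Literature/NumberTheory/LFunctions/RiemannSiegelChiStirling.lean`):

* `DirichletMVT.norm_weighted_meanSquare_activated_sub_le` — for `T ≤ T'`, `|w| ≤ W₀` on `[T,T']`,
  `∫_T^{T'} |w'| ≤ W₁`:
  `‖∫_T^{T'} w(t) |D(t)|² dt − Σ_{i,j : μ_j = μ_i} x_i x̄_j ∫_T^{T'} [τ_i ≤ t][τ_j ≤ t] w(t) dt‖`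
  `  ≤ (2W₀ + W₁) Σ_{i,j : μ_j ≠ μ_i} |x_i| |x_j| / |log μ_i − log μ_j|`
  (expand, integrate termwise over the pair-dependent ranges `t ≥ max(τ_i, τ_j)`, one integration
  by parts off the diagonal: `DirichletMVT.norm_integral_mul_exp_mul_I_le`,
  `‖∫_α^β w e^{itL}‖ ≤ (|w(α)| + |w(β)| + ∫|w'|)/|L|`);
* `DirichletMVT.norm_meanSquare_activated_sub_le` — `w ≡ 1`: diagonal
  `Σ_{μ_j = μ_i} x_i x̄_j (T' − max(T, τ_i, τ_j))₊`, error `2 Σ_{μ_j ≠ μ_i} |x_i||x_j|/|log μ_i − log μ_j|`;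
* `DirichletMVT.sum_sum_offDiag_div_abs_log_le` — if `1 ≤ μ_i ≤ M`:
  `Σ_{μ_j ≠ μ_i} |x_i||x_j|/|log μ_i − log μ_j| ≤ 2M(1 + log M) Σ_{μ_j = μ_i} |x_i||x_j|`
  (grouping by the value `m = μ_i`, `X_m = Σ_{μ_i = m} |x_i|`: the crude kernel bound
  `1/|log m − log m'| ≤ M/|m − m'|` and harmonic sums of `DirichletPolynomialCrudeMVT.lean`, and
  `Σ_m X_m² = Σ_{μ_j = μ_i} |x_i||x_j|`; for `μ = kn` the divisor-type multiplicities are carried by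
  `X_m`, cf. Levinson's Lemma 3.6), and the combination
  `DirichletMVT.norm_weighted_meanSquare_activated_sub_le_crude`.

With Levinson's `y = T^{1/2} (log T)^{−20}` the off-diagonal is `O(T (log T)^{−15})`, so the crude
kernel bound (rather than the Montgomery–Vaughan inequality) suffices.

## References

* E. C. Titchmarsh, *The Theory of the Riemann Zeta-Function*, 2nd ed. (rev. D. R. Heath-Brown),
  Oxford 1986, §7.4 (mean square via the approximate functional equation). [Titchmarsh1986]
* N. Levinson, Adv. Math. 13 (1974), 383–436, §2 eqs. (2.19)–(2.27), §3 Lemmas 3.2, 3.6, §4.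
  [Levinson1974]
-/

noncomputable section

open Finset Real MeasureTheory Complex Filter Topology Set intervalIntegral
open scoped ComplexConjugate

namespace Literature.NumberTheory.LFunctions

namespace DirichletMVT

/-! ### Indicators inside interval integrals -/

/-- `∫_T^{T'} [θ ≤ t] f(t) dt = [θ ≤ T'] ∫_{max(T,θ)}^{T'} f` for `T ≤ T'`. [folklore] -/
theorem integral_ite_le_eq (f : ℝ → ℂ) {T T' : ℝ} (θ : ℝ) (hTT' : T ≤ T') :
    ∫ t in T..T', (if θ ≤ t then f t else 0) =
      if θ ≤ T' then ∫ t in max T θ..T', f t else 0 := by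
  by_cases hθ : θ ≤ T'
  · rw [if_pos hθ]
    have hfun : (fun t => if θ ≤ t then f t else 0) = (Ici θ).indicator f := by
      funext t
      simp only [Set.indicator, Set.mem_Ici]
    rw [hfun, intervalIntegral.integral_of_le hTT', setIntegral_indicator measurableSet_Ici,
      intervalIntegral.integral_of_le (max_le hTT' hθ)]
    rcases le_or_gt θ T with h | h
    · rw [max_eq_left h]
      have hset : Ioc T T' ∩ Ici θ = Ioc T T' := by
        ext t
        simp only [Set.mem_inter_iff, Set.mem_Ioc, Set.mem_Ici]
        constructor
        · rintro ⟨h1, _⟩; exact h1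
        · rintro h1; exact ⟨h1, h.trans h1.1.le⟩
      rw [hset]
    · rw [max_eq_right h.le]
      have hset : Ioc T T' ∩ Ici θ = Icc θ T' := by
        ext t
        simp only [Set.mem_inter_iff, Set.mem_Ioc, Set.mem_Ici, Set.mem_Icc]
        constructor
        · rintro ⟨⟨_, h2⟩, h3⟩; exact ⟨h3, h2⟩
        · rintro ⟨h1, h2⟩; exact ⟨⟨h.trans_le h1, h2⟩, h1⟩
      rw [hset, integral_Icc_eq_integral_Ioc]
  · rw [if_neg hθ]
    have hzero : EqOn (fun t => if θ ≤ t then f t else 0) (fun _ => 0) (uIcc T T') := by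
      intro t ht
      rw [uIcc_of_le hTT'] at ht
      simp only
      rw [if_neg (fun h => hθ (h.trans ht.2))]
    rw [intervalIntegral.integral_congr hzero, intervalIntegral.integral_zero]

/-- An `if θ ≤ t then f t else 0` with `f` continuous on `[T, T']` is interval integrable there.
[folklore] -/
theorem intervalIntegrable_ite_le {f : ℝ → ℂ} {T T' θ : ℝ} (hTT' : T ≤ T')
    (hf : ContinuousOn f (Icc T T')) :
    IntervalIntegrable (fun t => if θ ≤ t then f t else 0) volume T T' := by
  have hfun : (fun t => if θ ≤ t then f t else 0) = (Ici θ).indicator f := by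
    funext t
    simp only [Set.indicator, Set.mem_Ici]
  rw [hfun, intervalIntegrable_iff_integrableOn_Ioc_of_le hTT']
  exact ((hf.integrableOn_Icc).mono_set Ioc_subset_Icc_self).indicator measurableSet_Ici

/-! ### Oscillatory integrals with a `C¹` weight -/

/-- **First-derivative bound with a `C¹` amplitude**: for `α ≤ β`, `L ≠ 0` and `w` with a
continuous derivative on `[α, β]`,
`‖∫_α^β w(t) e^{itL} dt‖ ≤ (|w(α)| + |w(β)| + ∫_α^β |w'|)/|L|` (one integration by parts).
[folklore] -/
theorem norm_integral_mul_exp_mul_I_le {w w' : ℝ → ℝ} {α β L : ℝ} (hαβ : α ≤ β) (hL : L ≠ 0)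
    (hw : ∀ t ∈ Icc α β, HasDerivAt w (w' t) t) (hw' : ContinuousOn w' (Icc α β)) :
    ‖∫ t in α..β, (w t : ℂ) * Complex.exp (((t * L : ℝ) : ℂ) * I)‖ ≤
      (|w α| + |w β| + ∫ t in α..β, |w' t|) / |L| := by
  have huIcc : uIcc α β = Icc α β := uIcc_of_le hαβ
  have hc : (L : ℂ) * I ≠ 0 := mul_ne_zero (Complex.ofReal_ne_zero.2 hL) Complex.I_ne_zero
  -- the primitive `V(t) = e^{itL}/(iL)` of `e^{itL}`
  have hV : ∀ t : ℝ, HasDerivAt (fun t : ℝ => Complex.exp (((t * L : ℝ) : ℂ) * I) / ((L : ℂ) * I))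
      (Complex.exp (((t * L : ℝ) : ℂ) * I)) t := by
    intro t
    have h1 : HasDerivAt (fun t : ℝ => ((t * L : ℝ) : ℂ) * I) ((L : ℂ) * I) t := by
      have h := ((hasDerivAt_id t).mul_const L).ofReal_comp.mul_const I
      refine h.congr_deriv ?_
      simp
    have h2 := (Complex.hasDerivAt_exp _).comp t h1
    have h3 := h2.div_const ((L : ℂ) * I)
    refine h3.congr_deriv ?_
    have hL' : (L : ℂ) ≠ 0 := Complex.ofReal_ne_zero.2 hL
    field_simp
  have hwc : ∀ t ∈ uIcc α β, HasDerivAt (fun t => (w t : ℂ)) ((w' t : ℂ)) t := fun t ht =>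
    (hw t (huIcc ▸ ht)).ofReal_comp
  have hw'int : IntervalIntegrable (fun t => (w' t : ℂ)) volume α β :=
    ((Complex.continuous_ofReal.comp_continuousOn hw').mono (by rw [huIcc])).intervalIntegrable
  have hexp_cont : Continuous fun t : ℝ => Complex.exp (((t * L : ℝ) : ℂ) * I) := by fun_prop
  have hparts := intervalIntegral.integral_mul_deriv_eq_deriv_mul (a := α) (b := β)
    (u := fun t => (w t : ℂ)) (v := fun t : ℝ => Complex.exp (((t * L : ℝ) : ℂ) * I) / ((L : ℂ) * I))
    hwc (fun t _ => hV t) hw'int (hexp_cont.intervalIntegrable _ _)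
  rw [hparts]
  have hnormV : ∀ t : ℝ, ‖Complex.exp (((t * L : ℝ) : ℂ) * I) / ((L : ℂ) * I)‖ = 1 / |L| := by
    intro t
    rw [norm_div, Complex.norm_exp_ofReal_mul_I, norm_mul, Complex.norm_real, Complex.norm_I,
      mul_one, Real.norm_eq_abs]
  have hLpos : 0 < |L| := abs_pos.2 hL
  have hint : ‖∫ t in α..β, (w' t : ℂ) * (Complex.exp (((t * L : ℝ) : ℂ) * I) / ((L : ℂ) * I))‖ ≤
      (∫ t in α..β, |w' t|) / |L| := by
    have hb : ∀ t, ‖(w' t : ℂ) * (Complex.exp (((t * L : ℝ) : ℂ) * I) / ((L : ℂ) * I))‖ =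
        |w' t| * (1 / |L|) := fun t => by
      rw [norm_mul, hnormV, Complex.norm_real, Real.norm_eq_abs]
    calc _ ≤ ∫ t in α..β, |w' t| * (1 / |L|) :=
          intervalIntegral.norm_integral_le_of_norm_le hαβ
            (Filter.Eventually.of_forall fun t _ => (hb t).le)
            (((continuous_abs.comp_continuousOn hw').intervalIntegrable_of_Icc hαβ).mul_const _)
      _ = (∫ t in α..β, |w' t|) / |L| := by
          rw [intervalIntegral.integral_mul_const]; ring
  calc _ ≤ ‖(w β : ℂ) * (Complex.exp (((β * L : ℝ) : ℂ) * I) / ((L : ℂ) * I)) -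
        (w α : ℂ) * (Complex.exp (((α * L : ℝ) : ℂ) * I) / ((L : ℂ) * I))‖ +
        ‖∫ t in α..β, (w' t : ℂ) * (Complex.exp (((t * L : ℝ) : ℂ) * I) / ((L : ℂ) * I))‖ :=
        norm_sub_le _ _
    _ ≤ (|w β| * (1 / |L|) + |w α| * (1 / |L|)) + (∫ t in α..β, |w' t|) / |L| := by
        gcongr
        refine (norm_sub_le _ _).trans ?_
        rw [norm_mul, norm_mul, hnormV, hnormV, Complex.norm_real, Complex.norm_real,
          Real.norm_eq_abs, Real.norm_eq_abs]
    _ = _ := by ring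

/-! ### The activated mean square -/

/-- **Mean square of an activated Dirichlet polynomial against a `C¹` weight.** Let `S` be a
finite index set, `x : ι → ℂ` coefficients, `μ : ι → ℕ` frequencies `≥ 1`, `τ : ι → ℝ`
activation times, and
`D(t) = Σ_{i ∈ S, τ_i ≤ t} x_i μ_i^{−it}`
(a Dirichlet polynomial whose terms are switched on at the times `τ_i`; e.g. `i = (k, n)`,
`μ = kn`, `τ = 2πn²` for `ψ(a+it) · Σ_{n ≤ √(t/2π)} c_n n^{−a−it}`, the mollified
Hardy–Littlewood / Riemann–Siegel main term of Levinson's `I₁₁`, `I₂₂`, Adv. Math. 13 (1974) §§2, 4).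
For `T ≤ T'` and a real weight `w` with a continuous derivative on `[T, T']`, `|w| ≤ W₀` there and
`∫_T^{T'} |w'| ≤ W₁`:
`‖∫_T^{T'} w(t) ‖D(t)‖² dt − Σ_{i,j ∈ S, μ_j = μ_i} x_i x̄_j ∫_T^{T'} [τ_i ≤ t][τ_j ≤ t] w(t) dt‖`
`  ≤ (2W₀ + W₁) Σ_{i,j ∈ S, μ_j ≠ μ_i} ‖x_i‖ ‖x_j‖ / |log μ_i − log μ_j|`
(expand the square, integrate termwise over the pair-dependent ranges `t ≥ max(τ_i, τ_j)`, and
bound each off-diagonal integral by one integration by parts, `norm_integral_mul_exp_mul_I_le`;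
Titchmarsh §7.4, Levinson §4). [cite: Titchmarsh1986, §7.4] -/
theorem norm_weighted_meanSquare_activated_sub_le {ι : Type*} (S : Finset ι) (x : ι → ℂ)
    (μ : ι → ℕ) (τ : ι → ℝ) (hμ : ∀ i ∈ S, 1 ≤ μ i) {T T' W₀ W₁ : ℝ} (hTT' : T ≤ T')
    {w w' : ℝ → ℝ} (hw : ∀ t ∈ Icc T T', HasDerivAt w (w' t) t)
    (hw' : ContinuousOn w' (Icc T T')) (hW₀ : ∀ t ∈ Icc T T', |w t| ≤ W₀)
    (hW₁ : ∫ t in T..T', |w' t| ≤ W₁) :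
    ‖(∫ t in T..T', (((w t * ‖∑ i ∈ S, (if τ i ≤ t then x i * (μ i : ℂ) ^ (-((t : ℂ) * I)) else 0)‖ ^ 2
          : ℝ) : ℂ)))
      - ∑ i ∈ S, ∑ j ∈ S with μ j = μ i, x i * conj (x j) *
          ∫ t in T..T', (if τ i ≤ t ∧ τ j ≤ t then ((w t : ℝ) : ℂ) else 0)‖ ≤
      (2 * W₀ + W₁) * ∑ i ∈ S, ∑ j ∈ S with μ j ≠ μ i,
        ‖x i‖ * ‖x j‖ / |Real.log (μ i) - Real.log (μ j)| := by
  classical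
  have huIcc : uIcc T T' = Icc T T' := uIcc_of_le hTT'
  have hW₀0 : 0 ≤ W₀ := (abs_nonneg _).trans (hW₀ T ⟨le_rfl, hTT'⟩)
  have hW₁0 : 0 ≤ W₁ := le_trans (intervalIntegral.integral_nonneg hTT' fun t _ => abs_nonneg _) hW₁
  have hwcont : ContinuousOn w (Icc T T') := fun t ht => (hw t ht).continuousAt.continuousWithinAt
  -- the activated terms and the pair phases
  set d : ι → ℝ → ℂ := fun i t => if τ i ≤ t then x i * (μ i : ℂ) ^ (-((t : ℂ) * I)) else 0 with hd
  set E : ι → ι → ℝ → ℂ := fun i j t =>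
    Complex.exp (((t * (Real.log (μ j) - Real.log (μ i)) : ℝ) : ℂ) * I) with hE
  have hEcont : ∀ i j, Continuous (E i j) := by intro i j; simp only [hE]; fun_prop
  have hdd : ∀ i ∈ S, ∀ j ∈ S, ∀ t : ℝ, d i t * conj (d j t) =
      if τ i ≤ t ∧ τ j ≤ t then x i * conj (x j) * E i j t else 0 := by
    intro i hi j hj t
    simp only [hd]
    by_cases h1 : τ i ≤ t
    · by_cases h2 : τ j ≤ t
      · simp only [h1, h2, if_true, and_self]
        rw [natCast_cpow_neg_mul_I (by have := hμ i hi; omega),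
          natCast_cpow_neg_mul_I (by have := hμ j hj; omega), map_mul, conj_exp_ofReal_mul_I]
        simp only [hE]
        rw [mul_mul_mul_comm, ← Complex.exp_add]
        congr 2
        push_cast
        ring
      · simp only [h1, h2, if_true, if_false, and_false, map_zero, mul_zero]
    · simp only [h1, if_false, false_and, zero_mul]
  -- the weighted pair functions and their integrals
  set P : ι → ι → ℝ → ℂ := fun i j t =>
    if τ i ≤ t ∧ τ j ≤ t then ((w t : ℝ) : ℂ) * (x i * conj (x j) * E i j t) else 0 with hP
  have hPalt : ∀ i j, P i j = fun t =>
      if max (τ i) (τ j) ≤ t then ((w t : ℝ) : ℂ) * (x i * conj (x j) * E i j t) else 0 := by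
    intro i j; funext t; simp only [hP, max_le_iff]
  have hPint : ∀ i j, IntervalIntegrable (P i j) volume T T' := by
    intro i j
    rw [hPalt]
    exact intervalIntegrable_ite_le hTT'
      ((Complex.continuous_ofReal.comp_continuousOn hwcont).mul
        (continuousOn_const.mul (hEcont i j).continuousOn))
  -- Step 1: the weighted square as a double sum, and termwise integration
  have hpt : ∀ t : ℝ, (((w t * ‖∑ i ∈ S, (if τ i ≤ t then x i * (μ i : ℂ) ^ (-((t : ℂ) * I)) else 0)‖ ^ 2
      : ℝ) : ℂ)) = ∑ i ∈ S, ∑ j ∈ S, P i j t := by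
    intro t
    rw [Complex.ofReal_mul, ofReal_norm_sq_sum_eq, Finset.mul_sum]
    refine Finset.sum_congr rfl fun i hi => ?_
    rw [Finset.mul_sum]
    refine Finset.sum_congr rfl fun j hj => ?_
    have h := hdd i hi j hj t
    simp only [hd] at h
    rw [h]
    simp only [hP, mul_ite, mul_zero]
  have hI : (∫ t in T..T', (((w t * ‖∑ i ∈ S, (if τ i ≤ t then x i * (μ i : ℂ) ^ (-((t : ℂ) * I))
      else 0)‖ ^ 2 : ℝ) : ℂ))) = ∑ i ∈ S, ∑ j ∈ S, ∫ t in T..T', P i j t := by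
    simp_rw [hpt]
    have hPint' : ∀ i, IntervalIntegrable (fun t => ∑ j ∈ S, P i j t) volume T T' := fun i => by
      have e : (fun t => ∑ j ∈ S, P i j t) = ∑ j ∈ S, P i j := by
        funext t
        exact (Finset.sum_apply t S (fun j => P i j)).symm
      rw [e]
      exact IntervalIntegrable.sum S (fun j _ => hPint i j)
    rw [intervalIntegral.integral_finsetSum fun i _ => hPint' i]
    refine Finset.sum_congr rfl fun i _ => ?_
    rw [intervalIntegral.integral_finsetSum fun j _ => hPint i j]
  -- Step 2: the diagonal pairs `μ j = μ i`
  have hdiag : ∀ i ∈ S, ∀ j ∈ S, μ j = μ i → ∫ t in T..T', P i j t =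
      x i * conj (x j) * ∫ t in T..T', (if τ i ≤ t ∧ τ j ≤ t then ((w t : ℝ) : ℂ) else 0) := by
    intro i hi j hj hij
    rw [← intervalIntegral.integral_const_mul]
    refine intervalIntegral.integral_congr fun t _ => ?_
    have hE1 : E i j t = 1 := by
      simp only [hE, hij, sub_self, mul_zero, Complex.ofReal_zero, zero_mul, Complex.exp_zero]
    simp only [hP, hE1, mul_one, mul_ite, mul_zero]
    split_ifs <;> ring
  -- Step 3: the off-diagonal pairs `μ j ≠ μ i`
  have hoff : ∀ i ∈ S, ∀ j ∈ S, μ j ≠ μ i → ‖∫ t in T..T', P i j t‖ ≤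
      (2 * W₀ + W₁) * (‖x i‖ * ‖x j‖ / |Real.log (μ i) - Real.log (μ j)|) := by
    intro i hi j hj hij
    have hμi : (0 : ℝ) < μ i := by exact_mod_cast hμ i hi
    have hμj : (0 : ℝ) < μ j := by exact_mod_cast hμ j hj
    have hL : Real.log (μ j) - Real.log (μ i) ≠ 0 := by
      intro h
      have h' : ((μ j : ℕ) : ℝ) = μ i :=
        Real.log_injOn_pos (Set.mem_Ioi.2 hμj) (Set.mem_Ioi.2 hμi) (sub_eq_zero.1 h)
      exact hij (by exact_mod_cast h')
    have hLabs : |Real.log (μ j) - Real.log (μ i)| = |Real.log (μ i) - Real.log (μ j)| :=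
      abs_sub_comm _ _
    have hLpos : 0 < |Real.log (μ i) - Real.log (μ j)| := by rw [← hLabs]; exact abs_pos.2 hL
    rw [hPalt, integral_ite_le_eq _ _ hTT']
    split_ifs with hθ
    · set α : ℝ := max T (max (τ i) (τ j)) with hα
      have hαT : T ≤ α := le_max_left _ _
      have hαT' : α ≤ T' := max_le hTT' hθ
      have hsub : Icc α T' ⊆ Icc T T' := Icc_subset_Icc hαT le_rfl
      rw [show (fun t => ((w t : ℝ) : ℂ) * (x i * conj (x j) * E i j t)) =
          fun t => (x i * conj (x j)) * (((w t : ℝ) : ℂ) * E i j t) from funext fun t => by ring,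
        intervalIntegral.integral_const_mul, norm_mul, norm_mul, Complex.norm_conj]
      have hosc := norm_integral_mul_exp_mul_I_le (w := w) (w' := w') hαT' hL
        (fun t ht => hw t (hsub ht)) (hw'.mono hsub)
      simp only [hE] at hosc ⊢
      have hwα : |w α| ≤ W₀ := hW₀ α ⟨hαT, hαT'⟩
      have hwT' : |w T'| ≤ W₀ := hW₀ T' ⟨hTT', le_rfl⟩
      have hw'int : ∫ t in α..T', |w' t| ≤ W₁ := by
        refine le_trans ?_ hW₁
        refine intervalIntegral.integral_mono_interval hαT hαT' le_rfl ?_ ?_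
        · exact Filter.Eventually.of_forall fun t => abs_nonneg _
        · exact ((continuous_abs.comp_continuousOn hw').mono (by rw [huIcc])).intervalIntegrable
      have hnum : |w α| + |w T'| + ∫ t in α..T', |w' t| ≤ 2 * W₀ + W₁ := by linarith
      rw [hLabs] at hosc
      calc ‖x i‖ * ‖x j‖ * ‖∫ t in α..T', ((w t : ℝ) : ℂ) *
            Complex.exp (((t * (Real.log (μ j) - Real.log (μ i)) : ℝ) : ℂ) * I)‖
          ≤ ‖x i‖ * ‖x j‖ * ((2 * W₀ + W₁) / |Real.log (μ i) - Real.log (μ j)|) := by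
            refine mul_le_mul_of_nonneg_left (hosc.trans ?_) (by positivity)
            exact div_le_div_of_nonneg_right hnum hLpos.le
        _ = _ := by ring
    · rw [norm_zero]; positivity
  -- Step 4: assemble
  have hsplit : ∀ i ∈ S, ∑ j ∈ S, ∫ t in T..T', P i j t =
      (∑ j ∈ S with μ j = μ i, x i * conj (x j) *
          ∫ t in T..T', (if τ i ≤ t ∧ τ j ≤ t then ((w t : ℝ) : ℂ) else 0)) +
        ∑ j ∈ S with μ j ≠ μ i, ∫ t in T..T', P i j t := by
    intro i hi
    rw [← Finset.sum_filter_add_sum_filter_not S (fun j => μ j = μ i)]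
    congr 1
    refine Finset.sum_congr rfl fun j hj => ?_
    rw [Finset.mem_filter] at hj
    exact hdiag i hi j hj.1 hj.2
  rw [hI, Finset.sum_congr rfl hsplit, Finset.sum_add_distrib, add_sub_cancel_left, Finset.mul_sum]
  refine norm_sum_le_of_le _ fun i hi => ?_
  rw [Finset.mul_sum]
  refine norm_sum_le_of_le _ fun j hj => ?_
  rw [Finset.mem_filter] at hj
  exact hoff i hi j hj.1 hj.2

/-! ### The unweighted case -/

/-- `∫_T^{T'} [a ≤ t][b ≤ t] dt = (T' − max(T, a, b))₊` for `T ≤ T'`. [folklore] -/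
theorem integral_ite_le_and_le_one {T T' a b : ℝ} (hTT' : T ≤ T') :
    ∫ t in T..T', (if a ≤ t ∧ b ≤ t then (1 : ℂ) else 0) =
      ((max 0 (T' - max T (max a b)) : ℝ) : ℂ) := by
  have e : (fun t : ℝ => if a ≤ t ∧ b ≤ t then (1 : ℂ) else 0) =
      fun t => if max a b ≤ t then (fun _ => (1 : ℂ)) t else 0 := by
    funext t; simp only [max_le_iff]
  rw [e, integral_ite_le_eq _ _ hTT']
  split_ifs with h
  · rw [intervalIntegral.integral_const, Complex.real_smul, mul_one,
      max_eq_right (sub_nonneg.2 (max_le hTT' h))]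
  · rw [max_eq_left]
    · simp
    · have : T' < max T (max a b) := lt_of_lt_of_le (lt_of_not_ge h) (le_max_right _ _)
      linarith

/-- **Mean square of an activated Dirichlet polynomial** (`w ≡ 1`): with the notation of
`norm_weighted_meanSquare_activated_sub_le`, for `T ≤ T'`,
`‖∫_T^{T'} ‖D(t)‖² dt − Σ_{i,j ∈ S, μ_j = μ_i} x_i x̄_j (T' − max(T, τ_i, τ_j))₊‖`
`  ≤ 2 Σ_{i,j ∈ S, μ_j ≠ μ_i} ‖x_i‖ ‖x_j‖ / |log μ_i − log μ_j|`
(Titchmarsh §7.4: the diagonal with the pair-dependent ranges, `|∫ (μ_j/μ_i)^{it} dt| ≤ 2/|log(μ_j/μ_i)|`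
off the diagonal). [cite: Titchmarsh1986, §7.4] -/
theorem norm_meanSquare_activated_sub_le {ι : Type*} (S : Finset ι) (x : ι → ℂ)
    (μ : ι → ℕ) (τ : ι → ℝ) (hμ : ∀ i ∈ S, 1 ≤ μ i) {T T' : ℝ} (hTT' : T ≤ T') :
    ‖(∫ t in T..T', (((‖∑ i ∈ S, (if τ i ≤ t then x i * (μ i : ℂ) ^ (-((t : ℂ) * I)) else 0)‖ ^ 2
          : ℝ) : ℂ)))
      - ∑ i ∈ S, ∑ j ∈ S with μ j = μ i, x i * conj (x j) *
          ((max 0 (T' - max T (max (τ i) (τ j))) : ℝ) : ℂ)‖ ≤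
      2 * ∑ i ∈ S, ∑ j ∈ S with μ j ≠ μ i, ‖x i‖ * ‖x j‖ / |Real.log (μ i) - Real.log (μ j)| := by
  have h := norm_weighted_meanSquare_activated_sub_le S x μ τ hμ hTT' (w := fun _ => 1)
    (w' := fun _ => 0) (W₀ := 1) (W₁ := 0) (fun t _ => hasDerivAt_const t 1) continuousOn_const
    (fun t _ => by simp) (by simp)
  simp only [one_mul, Complex.ofReal_one, integral_ite_le_and_le_one hTT'] at h
  have e : (2 : ℝ) * 1 + 0 = 2 := by norm_num
  rw [e] at h
  exact h

/-! ### The off-diagonal sum via the crude kernel bound -/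

/-- **Off-diagonal bound by fibres.** If `1 ≤ μ_i ≤ M` on `S`, then
`Σ_{i,j ∈ S, μ_j ≠ μ_i} ‖x_i‖ ‖x_j‖ / |log μ_i − log μ_j| ≤ 2M(1 + log M) Σ_{i,j ∈ S, μ_j = μ_i} ‖x_i‖ ‖x_j‖`:
group the indices by the value `m = μ_i` (`X_m = Σ_{μ_i = m} ‖x_i‖`), use
`1/|log m − log m'| ≤ M/|m − m'|` (`DirichletMVT.abs_sub_div_le_abs_log_sub`), Young's inequality
with the symmetric kernel (`sum_sum_mul_mul_le_of_symm`) and the harmonic row sums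
`Σ_{m' ≠ m} 1/|m − m'| ≤ 2(1 + log M)` (`DirichletMVT.sum_one_div_abs_sub_le`); finally
`Σ_m X_m² = Σ_{μ_j = μ_i} ‖x_i‖ ‖x_j‖`. (For `μ = kn` on pairs `(k, n)` the right side carries the
divisor-type multiplicities through `X_m`, as in Levinson's Lemma 3.6.) [folklore] -/
theorem sum_sum_offDiag_div_abs_log_le {ι : Type*} (S : Finset ι) (x : ι → ℂ) (μ : ι → ℕ)
    {M : ℕ} (hμ : ∀ i ∈ S, 1 ≤ μ i) (hμM : ∀ i ∈ S, μ i ≤ M) :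
    ∑ i ∈ S, ∑ j ∈ S with μ j ≠ μ i, ‖x i‖ * ‖x j‖ / |Real.log (μ i) - Real.log (μ j)| ≤
      2 * M * (1 + Real.log M) * ∑ i ∈ S, ∑ j ∈ S with μ j = μ i, ‖x i‖ * ‖x j‖ := by
  classical
  -- fibre sums
  set X : ℕ → ℝ := fun m => ∑ i ∈ S with μ i = m, ‖x i‖ with hX
  have hX0 : ∀ m, 0 ≤ X m := fun m => Finset.sum_nonneg fun i _ => norm_nonneg _
  set R : Finset ℕ := Finset.Icc 1 M with hR
  have hμR : ∀ i ∈ S, μ i ∈ R := fun i hi => by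
    rw [hR, Finset.mem_Icc]; exact ⟨hμ i hi, hμM i hi⟩
  -- regrouping of sums over `S` by the values of `μ`
  have hfib : ∀ (G : ι → ℝ) (H : ℕ → ℝ),
      ∑ i ∈ S, G i * H (μ i) = ∑ m ∈ R, (∑ i ∈ S with μ i = m, G i) * H m := by
    intro G H
    rw [← Finset.sum_fiberwise_of_maps_to (s := S) (t := R) (g := μ) (fun i hi => hμR i hi)
      (fun i => G i * H (μ i))]
    refine Finset.sum_congr rfl fun m _ => ?_
    rw [Finset.sum_mul]
    refine Finset.sum_congr rfl fun i hi => ?_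
    rw [(Finset.mem_filter.1 hi).2]
  have hregroup : ∀ (F : ℕ → ℕ → ℝ),
      ∑ i ∈ S, ∑ j ∈ S, ‖x i‖ * ‖x j‖ * F (μ i) (μ j) =
        ∑ m ∈ R, ∑ m' ∈ R, X m * X m' * F m m' := by
    intro F
    have step1 : ∀ i ∈ S, ∑ j ∈ S, ‖x i‖ * ‖x j‖ * F (μ i) (μ j) =
        ‖x i‖ * ∑ m' ∈ R, X m' * F (μ i) m' := by
      intro i _
      rw [← hfib (fun j => ‖x j‖) (F (μ i)), Finset.mul_sum]
      refine Finset.sum_congr rfl fun j _ => ?_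
      ring
    rw [Finset.sum_congr rfl step1, hfib (fun i => ‖x i‖) (fun m => ∑ m' ∈ R, X m' * F m m')]
    refine Finset.sum_congr rfl fun m _ => ?_
    rw [Finset.mul_sum]
    refine Finset.sum_congr rfl fun m' _ => ?_
    ring
  -- the left side with the kernel `[m ≠ m'] / |log m − log m'|`
  set Koff : ℕ → ℕ → ℝ := fun m m' => if m' = m then 0 else 1 / |Real.log m - Real.log m'| with hKoff
  have hLHS : ∑ i ∈ S, ∑ j ∈ S with μ j ≠ μ i, ‖x i‖ * ‖x j‖ / |Real.log (μ i) - Real.log (μ j)| =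
      ∑ i ∈ S, ∑ j ∈ S, ‖x i‖ * ‖x j‖ * Koff (μ i) (μ j) := by
    refine Finset.sum_congr rfl fun i _ => ?_
    rw [Finset.sum_filter]
    refine Finset.sum_congr rfl fun j _ => ?_
    by_cases h : μ j = μ i
    · have h1 : Koff (μ i) (μ j) = 0 := by simp only [hKoff]; rw [if_pos h]
      rw [h1, if_neg (fun h' => h' h), mul_zero]
    · have h1 : Koff (μ i) (μ j) = 1 / |Real.log (μ i) - Real.log (μ j)| := by
        simp only [hKoff]; rw [if_neg h]
      rw [h1, if_pos h, div_eq_mul_one_div]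
  -- the right side with the kernel `[m = m']`
  have hRHS : ∑ i ∈ S, ∑ j ∈ S with μ j = μ i, ‖x i‖ * ‖x j‖ =
      ∑ i ∈ S, ∑ j ∈ S, ‖x i‖ * ‖x j‖ * (if μ j = μ i then 1 else 0) := by
    refine Finset.sum_congr rfl fun i _ => ?_
    rw [Finset.sum_filter]
    refine Finset.sum_congr rfl fun j _ => ?_
    by_cases h : μ j = μ i
    · rw [if_pos h, if_pos h, mul_one]
    · rw [if_neg h, if_neg h, mul_zero]
  rw [hLHS, hregroup (fun m m' => Koff m m'), hRHS,
    hregroup (fun m m' => if m' = m then 1 else 0)]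
  -- `Σ_{m'} X m X m' [m' = m] = X m ^ 2` on `R`
  have hdiagR : ∑ m ∈ R, ∑ m' ∈ R, X m * X m' * (if m' = m then (1 : ℝ) else 0) = ∑ m ∈ R, X m ^ 2 := by
    refine Finset.sum_congr rfl fun m hm => ?_
    simp only [mul_ite, mul_one, mul_zero]
    rw [Finset.sum_ite_eq', if_pos hm]
    ring
  rw [hdiagR]
  -- the crude kernel bound
  set K : ℕ → ℕ → ℝ := fun m m' => if m = m' then 0 else M / |(m' : ℝ) - m| with hK
  have hKsymm : ∀ m n, K m n = K n m := by
    intro m n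
    simp only [hK]
    by_cases h : m = n
    · simp [h]
    · rw [if_neg h, if_neg (Ne.symm h), abs_sub_comm]
  have hK0 : ∀ m n, 0 ≤ K m n := by
    intro m n; simp only [hK]; split_ifs <;> positivity
  have hKoff_le : ∀ m ∈ R, ∀ m' ∈ R, Koff m m' ≤ K m m' := by
    intro m hm m' hm'
    rw [hR, Finset.mem_Icc] at hm hm'
    simp only [hKoff, hK]
    by_cases h : m' = m
    · rw [if_pos h, if_pos h.symm]
    · rw [if_neg h, if_neg (Ne.symm h)]
      have hlog := abs_sub_div_le_abs_log_sub hm'.1 hm'.2 hm.1 hm.2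
      have hne : 0 < |(m : ℝ) - m'| := abs_pos.2 (sub_ne_zero.2 (by exact_mod_cast Ne.symm h))
      have hMpos : (0 : ℝ) < M := by exact_mod_cast (hm.1.trans hm.2)
      calc 1 / |Real.log m - Real.log m'| ≤ 1 / (|(m : ℝ) - m'| / M) :=
            div_le_div_of_nonneg_left (by norm_num) (by positivity) hlog
        _ = M / |(m' : ℝ) - m| := by rw [abs_sub_comm]; field_simp
  have hrow : ∀ m' ∈ R, ∑ m ∈ R, K m m' ≤ 2 * M * (1 + Real.log M) := by
    intro m' hm'
    rw [hR, Finset.mem_Icc] at hm'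
    have e1 : ∑ m ∈ R, K m m' = ∑ m ∈ R.filter (fun m => m ≠ m'), (M : ℝ) / |(m' : ℝ) - m| := by
      rw [Finset.sum_filter]
      refine Finset.sum_congr rfl fun m _ => ?_
      simp only [hK, ite_not]
    have e2 : ∑ m ∈ R.filter (fun m => m ≠ m'), (M : ℝ) / |(m' : ℝ) - m| =
        M * ∑ m ∈ R.filter (fun m => m ≠ m'), 1 / |(m : ℝ) - m'| := by
      rw [Finset.mul_sum]
      refine Finset.sum_congr rfl fun m _ => ?_
      rw [abs_sub_comm]; ring
    rw [e1, e2]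
    have h := sum_one_div_abs_sub_le hm'.1 hm'.2
    have hM : (0 : ℝ) ≤ M := Nat.cast_nonneg M
    nlinarith
  calc ∑ m ∈ R, ∑ m' ∈ R, X m * X m' * Koff m m'
      ≤ ∑ m ∈ R, ∑ m' ∈ R, X m * X m' * K m m' :=
        Finset.sum_le_sum fun m hm => Finset.sum_le_sum fun m' hm' =>
          mul_le_mul_of_nonneg_left (hKoff_le m hm m' hm') (mul_nonneg (hX0 m) (hX0 m'))
    _ ≤ ∑ m' ∈ R, X m' ^ 2 * ∑ m ∈ R, K m m' := sum_sum_mul_mul_le_of_symm R X K hKsymm hK0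
    _ ≤ ∑ m' ∈ R, X m' ^ 2 * (2 * M * (1 + Real.log M)) :=
        Finset.sum_le_sum fun m' hm' => mul_le_mul_of_nonneg_left (hrow m' hm') (sq_nonneg _)
    _ = 2 * M * (1 + Real.log M) * ∑ m ∈ R, X m ^ 2 := by rw [← Finset.sum_mul]; ring

/-- **The activated mean square, crude form**: with `1 ≤ μ_i ≤ M` on `S`, `T ≤ T'`, `|w| ≤ W₀`,
`∫_T^{T'}|w'| ≤ W₁`,
`‖∫_T^{T'} w |D|² − Σ_{μ_j = μ_i} x_i x̄_j ∫_T^{T'} [τ_i ≤ t][τ_j ≤ t] w‖ ≤ (2W₀ + W₁) · 2M(1 + log M) · Σ_{μ_j = μ_i} |x_i||x_j|`.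
[cite: Titchmarsh1986, §7.4] -/
theorem norm_weighted_meanSquare_activated_sub_le_crude {ι : Type*} (S : Finset ι) (x : ι → ℂ)
    (μ : ι → ℕ) (τ : ι → ℝ) {M : ℕ} (hμ : ∀ i ∈ S, 1 ≤ μ i) (hμM : ∀ i ∈ S, μ i ≤ M)
    {T T' W₀ W₁ : ℝ} (hTT' : T ≤ T') {w w' : ℝ → ℝ} (hw : ∀ t ∈ Icc T T', HasDerivAt w (w' t) t)
    (hw' : ContinuousOn w' (Icc T T')) (hW₀ : ∀ t ∈ Icc T T', |w t| ≤ W₀)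
    (hW₁ : ∫ t in T..T', |w' t| ≤ W₁) :
    ‖(∫ t in T..T', (((w t * ‖∑ i ∈ S, (if τ i ≤ t then x i * (μ i : ℂ) ^ (-((t : ℂ) * I)) else 0)‖ ^ 2
          : ℝ) : ℂ)))
      - ∑ i ∈ S, ∑ j ∈ S with μ j = μ i, x i * conj (x j) *
          ∫ t in T..T', (if τ i ≤ t ∧ τ j ≤ t then ((w t : ℝ) : ℂ) else 0)‖ ≤
      (2 * W₀ + W₁) * (2 * M * (1 + Real.log M)) *
        ∑ i ∈ S, ∑ j ∈ S with μ j = μ i, ‖x i‖ * ‖x j‖ := by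
  have hW₀0 : 0 ≤ W₀ := (abs_nonneg _).trans (hW₀ T ⟨le_rfl, hTT'⟩)
  have hW₁0 : 0 ≤ W₁ := le_trans (intervalIntegral.integral_nonneg hTT' fun t _ => abs_nonneg _) hW₁
  refine (norm_weighted_meanSquare_activated_sub_le S x μ τ hμ hTT' hw hw' hW₀ hW₁).trans ?_
  rw [mul_assoc]
  exact mul_le_mul_of_nonneg_left (sum_sum_offDiag_div_abs_log_le S x μ hμ hμM) (by positivity)

end DirichletMVT

end Literature.NumberTheory.LFunctions
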